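import Literature.NumberTheory.LFunctions.MertensErrorTermsMeanValueRHProductWindow
import HarnessLib

/-!
# RH-EQUIVALENT / RH-CONDITIONAL literature, proof layer — «nothing here bears on the truth of RH»
# Zhao 2025, Theorem 1 (`i = 2`) and Theorem 2 (first clause), sufficiency halves in eventual form PROVED:
# `RH ⟹ ∫₂^X E₂(x) dx → +∞` and `RH ⟹ ∫₂^X E₃(x) dx → +∞`

Proof companion of `MertensErrorTermsMeanValueRH.lean` (T. Zhao, Res. Number Theory 11 (2025) 62 =
arXiv:2411.18903 [bib: `Zhao2025MertensMean`]); theorems only, no definition, no named fact. §2 of the source shows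
under RH that `∫₂^X E₂(x) dx > 0` for all `X > 2` (for `X ≥ 10⁸` by (2.5) and the explicit formula, below `10⁸` by the
numerical input "`E₂(x) > 0` for `2 ≤ x ≤ 10⁸`" of [RS]); §4 opens with `∫₂^X E₃ = e^γ ∫₂^X (e^{E₂} − 1)` and concludes
the first clause of Theorem 2 (`Θ = 1/2 ⟹ ∫₂^X E₃ > 0` for all `X > 2`). This file PROVES the large-`X` parts without
numerics, as the `i = 1` companion `MertensErrorTermsMeanValueRHSufficiency.lean` did for `E₁`:

* `Zhao2025.tendsto_integral_E₂_atTop_of_RH` — `RH ⟹ ∫₂^X E₂ → +∞` (indeed `≥ C + (1 − B₁)√X/log X`, from (2.5)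
  `Zhao2025.integral_E₂_eq` and the upper tail bound `Zhao2025.eventually_mul_piLiTail_le_of_RH`), hence
  `Zhao2025.eventually_integral_E₂_pos_of_RH`;
* `Zhao2025.tendsto_integral_E₃_atTop_of_RH` — `RH ⟹ ∫₂^X E₃ → +∞` (`E₃ ≥ e^γ(E₂ − 2/x)`, `Zhao2025.E₃_ge`, and
  `log X = o(√X/log X)`), hence `Zhao2025.eventually_integral_E₃_pos_of_RH` — the first clause of the named fact
  `Zhao2025MertensMean_thm2` for all sufficiently large `X`.

The residual finite ranges `2 < X ≤ X₀` of the printed statements rest on the source's numerical inputs and are NOT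
formalized; the necessity halves for `i = 2` (Landau's theorem for `Π − li`, §3 of the source) are not done here.
-/

noncomputable section

open Filter Topology Set MeasureTheory Asymptotics
open scoped Real Chebyshev

namespace Literature.NumberTheory.LFunctions

namespace Zhao2025

/-! ### Growth lemmas: `√X/log X → ∞`, `log² X = o(√X)` -/

/-- `K · log² x ≤ √x` for all large `x` (`log² = o(x^{1/2})`); plumbing. [cite: Zhao2025MertensMean, §2 (proof of Thm 1 for E₂)] -/
theorem eventually_mul_log_sq_le_sqrt (K : ℝ) : ∀ᶠ x : ℝ in atTop, K * Real.log x ^ 2 ≤ Real.sqrt x := by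
  have h := (isLittleO_log_rpow_rpow_atTop (2 : ℝ) (by norm_num : (0 : ℝ) < 1 / 2)).def
    (by positivity : (0 : ℝ) < 1 / (|K| + 1))
  filter_upwards [h, eventually_ge_atTop (1 : ℝ)] with x hx hx1
  have hx0 : 0 ≤ x := by linarith
  rw [Real.rpow_two, Real.norm_of_nonneg (by positivity),
    Real.norm_of_nonneg (Real.rpow_nonneg hx0 _), ← Real.sqrt_eq_rpow] at hx
  have hs : 0 ≤ Real.sqrt x := Real.sqrt_nonneg x
  have h1 : (|K| + 1) * Real.log x ^ 2 ≤ Real.sqrt x := by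
    have := mul_le_mul_of_nonneg_left hx (by positivity : (0 : ℝ) ≤ |K| + 1)
    rw [← mul_assoc, mul_one_div_cancel (by positivity : |K| + 1 ≠ 0), one_mul] at this
    exact this
  nlinarith [sq_nonneg (Real.log x), le_abs_self K]

/-- `√X/log X → +∞`. [cite: Zhao2025MertensMean, §1.1 (definition of f₂ in (1.1))] -/
theorem tendsto_sqrt_div_log_atTop : Tendsto (fun X : ℝ => Real.sqrt X / Real.log X) atTop atTop := by
  refine tendsto_atTop.2 fun M => ?_
  filter_upwards [eventually_mul_log_le_mul_sqrt (le_max_right M 0) one_pos, eventually_gt_atTop (1 : ℝ)]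
    with X hX hX1
  have hL : 0 < Real.log X := Real.log_pos hX1
  rw [le_div_iff₀ hL]
  exact le_trans (mul_le_mul_of_nonneg_right (le_max_left M 0) hL.le) (by linarith)

/-! ### `RH ⟹ ∫₂^X E₂ → +∞` -/

/-- **Zhao 2025, Thm 1 (`i = 2`), sufficiency half in eventual form, PROVED**: under RH,
`∫₂^X E₂(x) dx ≥ C + (1 − B₁)√X/log X` for large `X`, hence `∫₂^X E₂(x) dx → +∞`
((2.5): `∫₂^X E₂ = 2T₂(2) − X T₂(X)`, and `X T₂(X) ≤ (B₁ − 1)√X/log X` eventually). [cite: Zhao2025MertensMean, Thm 1 (i = 2, sufficiency)] -/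
theorem tendsto_integral_E₂_atTop_of_RH (hRH : RiemannHypothesis) :
    Tendsto (fun X : ℝ => ∫ x in (2 : ℝ)..X, E₂ x) atTop atTop := by
  have hβ1 : nicolasBeta < 1 := by linarith [nicolasBeta_lt']
  set C : ℝ := 2 * ∫ t in Ioi (2 : ℝ), ((Nat.primeCounting ⌊t⌋₊ : ℝ) - logIntegral t) / t ^ 2 with hC
  have hlow : ∀ᶠ X : ℝ in atTop, C + (1 - nicolasBeta) * (Real.sqrt X / Real.log X) ≤ ∫ x in (2 : ℝ)..X, E₂ x := by
    filter_upwards [eventually_mul_piLiTail_le_of_RH hRH one_pos, eventually_ge_atTop (2 : ℝ)] with X hX hX2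
    rw [integral_E₂_eq hX2]
    have e : (nicolasBeta - 2 + 1) * Real.sqrt X / Real.log X = -((1 - nicolasBeta) * (Real.sqrt X / Real.log X)) := by
      ring
    rw [e] at hX
    linarith
  refine tendsto_atTop_mono' atTop hlow ?_
  exact tendsto_atTop_add_const_left _ _ (Tendsto.const_mul_atTop (by linarith) tendsto_sqrt_div_log_atTop)

/-- **Under RH, `∫₂^X E₂(x) dx > 0` for all sufficiently large `X`.** [cite: Zhao2025MertensMean, Thm 1 (i = 2, sufficiency)] -/
theorem eventually_integral_E₂_pos_of_RH (hRH : RiemannHypothesis) :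
    ∀ᶠ X : ℝ in atTop, 0 < ∫ x in (2 : ℝ)..X, E₂ x :=
  (tendsto_integral_E₂_atTop_of_RH hRH).eventually_gt_atTop 0

/-! ### `RH ⟹ ∫₂^X E₃ → +∞` -/

/-- `∫₂^X E₃ ≥ e^γ (∫₂^X E₂ − 2 log(X/2))` for `X ≥ 2` (`E₃ ≥ e^γ(E₂ − 2/x)` integrated).
[cite: Zhao2025MertensMean, §4 (first display)] -/
theorem integral_E₃_ge {X : ℝ} (hX : 2 ≤ X) :
    Real.exp Real.eulerMascheroniConstant * ((∫ x in (2 : ℝ)..X, E₂ x) - 2 * Real.log (X / 2)) ≤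
      ∫ x in (2 : ℝ)..X, E₃ x := by
  have hX0 : 0 < X := by linarith
  have hc0 : 0 < 2 / X := by positivity
  have e : 2 / X * X = 2 := by field_simp
  have h := integral_window_E₃_ge (c := 2 / X) (X := X) hc0 (by rw [e]) (by rw [e]; exact hX)
  rw [e, show (2 / X)⁻¹ = X / 2 by rw [inv_div]] at h
  exact h

/-- **Zhao 2025, Thm 2 (first clause), eventual form, PROVED**: under RH, `∫₂^X E₃(x) dx → +∞`
(`∫₂^X E₃ ≥ e^γ(∫₂^X E₂ − 2 log(X/2))`, `∫₂^X E₂ ≥ C + (1 − B₁)√X/log X`, `log X = o(√X/log X)`).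
[cite: Zhao2025MertensMean, Thm 2 (Θ = 1/2)] -/
theorem tendsto_integral_E₃_atTop_of_RH (hRH : RiemannHypothesis) :
    Tendsto (fun X : ℝ => ∫ x in (2 : ℝ)..X, E₃ x) atTop atTop := by
  have hβ1 : nicolasBeta < 1 := by linarith [nicolasBeta_lt']
  have hγ := Real.exp_pos Real.eulerMascheroniConstant
  set C : ℝ := 2 * ∫ t in Ioi (2 : ℝ), ((Nat.primeCounting ⌊t⌋₊ : ℝ) - logIntegral t) / t ^ 2 with hC
  -- `2 log X ≤ ((1 − B₁)/2) √X/log X` eventually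
  have hlog : ∀ᶠ X : ℝ in atTop, 2 * Real.log X ≤ (1 - nicolasBeta) / 2 * (Real.sqrt X / Real.log X) := by
    filter_upwards [eventually_mul_log_sq_le_sqrt (4 / (1 - nicolasBeta)), eventually_gt_atTop (1 : ℝ)] with X hX hX1
    have hL : 0 < Real.log X := Real.log_pos hX1
    rw [mul_div_assoc', le_div_iff₀ hL]
    have hb : (1 - nicolasBeta) ≠ 0 := by linarith
    have e : 4 / (1 - nicolasBeta) * Real.log X ^ 2 * ((1 - nicolasBeta) / 2) = 2 * Real.log X * Real.log X := by
      field_simp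
      ring
    have := mul_le_mul_of_nonneg_right hX (by linarith : (0 : ℝ) ≤ (1 - nicolasBeta) / 2)
    rw [e] at this
    linarith
  have hlow : ∀ᶠ X : ℝ in atTop,
      Real.exp Real.eulerMascheroniConstant * (C + (1 - nicolasBeta) / 2 * (Real.sqrt X / Real.log X)) ≤
        ∫ x in (2 : ℝ)..X, E₃ x := by
    filter_upwards [eventually_mul_piLiTail_le_of_RH hRH one_pos, eventually_ge_atTop (2 : ℝ), hlog]
      with X hX hX2 hXl
    have hX0 : 0 < X := by linarith
    refine le_trans ?_ (integral_E₃_ge hX2)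
    refine mul_le_mul_of_nonneg_left ?_ hγ.le
    rw [integral_E₂_eq hX2]
    have e : (nicolasBeta - 2 + 1) * Real.sqrt X / Real.log X = -((1 - nicolasBeta) * (Real.sqrt X / Real.log X)) := by
      ring
    rw [e] at hX
    have hl2 : Real.log (X / 2) ≤ Real.log X := Real.log_le_log (by positivity) (by linarith)
    linarith
  refine tendsto_atTop_mono' atTop hlow ?_
  refine Tendsto.const_mul_atTop hγ ?_
  exact tendsto_atTop_add_const_left _ _ (Tendsto.const_mul_atTop (by linarith) tendsto_sqrt_div_log_atTop)

/-- **Under RH, `∫₂^X E₃(x) dx > 0` for all sufficiently large `X`** (Thm 2, first clause, eventual form).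
[cite: Zhao2025MertensMean, Thm 2 (Θ = 1/2)] -/
theorem eventually_integral_E₃_pos_of_RH (hRH : RiemannHypothesis) :
    ∀ᶠ X : ℝ in atTop, 0 < ∫ x in (2 : ℝ)..X, E₃ x :=
  (tendsto_integral_E₃_atTop_of_RH hRH).eventually_gt_atTop 0

end Zhao2025

end Literature.NumberTheory.LFunctions
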